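import Literature.Probability.RandomPlanarGeometry.LSW2004USTUniformContinuity
import Literature.Probability.RandomPlanarGeometry.LoewnerSimpleIncrement
import Literature.Probability.RandomPlanarGeometry.USTPeanoPathGeometry
import HarnessLib

/-!
# [LSW04] Lemma 4.6 as printed: `Y(t₁, t₂) = diam(g_{t₁} ∘ γ̂[t₁, t₂])`, and the forms used in the tree

G. F. Lawler, O. Schramm, W. Werner, *Conformal invariance of planar loop-erased random walks and
uniform spanning trees*, Ann. Probab. **32** (2004) 939–995 (**[LSW04]**), §4.3. Proof-only file
(no definition, no named fact).

`LSW2004USTUniformContinuity.lean` proves [LSW04] Prop. 4.5 — and with it Thm. 4.7,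
`Literature.Probability.RandomPlanarGeometry.hasSLETrace_eight` — from Thm. 4.4 and **Lemma 4.6**
(p. 978: "For `0 < t₁ < t₂ < ∞` let `Y(t₁, t₂) := diam(g_{t₁} ∘ γ̂[t₁, t₂])`. For every `ε > 0`
there is a `δ = δ(D, ε) > 0` and an `R₀ = R₀(D, ε) > 0` such that for all `R ≥ R₀`,
`P[sup{|γ̂(t₂) - γ̂(t₁)| : 0 ≤ t₁ ≤ t₂ ≤ τ, Y(t₁, t₂) ≤ δ} ≥ ε] < ε`, where
`τ := inf{t ≥ 0 : |γ̂(t)| = ε⁻¹}`"), taking Lemma 4.6 as a hypothesis in one of two shapes in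
which the smallness condition "`Y(t₁, t₂) ≤ δ`" is replaced by a condition on the Loewner side:
the *oscillation form* ("`√(t₂ - t₁) ≤ δ` and `|W(s) - W(t₁)| ≤ δ` on `[t₁, t₂]`", hypothesis of
`USTPeano.prop45_of_lemma46_of_drivingProcess_tendsto`) and the *hull form* ("the hull at time
`t₂ - t₁` of the chain driven by `W(t₁ + ·)` lies in the closed `δ`-disc about `W(t₁)`",
`USTPeano.prop45_of_lemma46hull_of_drivingProcess_tendsto`), the implication from the printed
lemma being argued in its docstrings. This file states Lemma 4.6 with **`Y(t₁, t₂)` as printed**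
and PROVES those implications, so that the remaining UST input can be discharged in its printed
form:

* LSW's set `g_{t₁} ∘ γ̂[t₁, t₂]` is, in the tree's vocabulary, the image of `[0, t₂ - t₁]` under
  the **increment curve** `Loewner.incrCurve W γ̂ t₁` (`LoewnerSimpleIncrement.lean`:
  `β(u) = g_{t₁}(γ̂(t₁ + u))` for `u > 0` and `β(0) = W(t₁)`, the boundary value
  `g_{t₁}(γ̂(t₁)) = W(t₁)` of [LSW04] §2.1, "`W(t) := gₜ(η(t))`"); so
  `Y(t₁, t₂) = diam (incrCurve W γ̂ t₁ '' [0, t₂ - t₁])` (`Metric.ediam`, no junk values);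
* `USTPeano.IsCapacityImage.im_pos`, `.injective`, `.isSimpleTrace`, `.driving_zero` — the
  capacity image `γ̂ = φ_R ∘ γ` of a UST Peano path is a simple curve with `γ̂(0, ∞) ⊆ ℍ`,
  `γ̂(0) = W(0) = 0` (the Peano path is a simple polygon inside `D`, `PeanoPath.injOn_curve`,
  `PeanoPath.curve_mem_carrier`, [LSW04] §4.1), which is what the increment-curve theory needs;
* `Loewner.norm_incrCurve_sub_driving_le`, `Loewner.ediam_image_incrCurve_le` — **"Lemma 2.1
  applied to the path `t ↦ g_{t₁} ∘ γ̂(t + t₁) - W(t₁)`"** ([LSW04] proof of Prop. 4.5): for a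
  chain generated by a simple curve, `Y(t₁, t₂) ≤ 2 (osc_{[t₁, t₂]} W + 4√(t₂ - t₁))` (the points
  `g_{t₁}(γ̂(t₁ + u))` lie in the hulls of the shifted chain, `Loewner.incrCurve_mem_hull`, which
  are controlled by [LSW04] Lemma 2.1 = `Loewner.hull_subset_closedBall_driving`, Lawler's
  Lemma 4.13); and `Loewner.hull_shift_subset_closedBall_of_ediam_le` — conversely `Y(t₁, t₂) ≤ δ`
  puts the shifted hull, which IS `g_{t₁}(γ̂(t₁, t₂])` for a simple curve
  (`Loewner.hull_shift_eq_image_incrCurve`), in the closed `δ`-disc about `W(t₁)`;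
* `USTPeano.lemma46osc_of_lemma46diam` (**printed form ⇒ oscillation form**, `δ ↦ δ/10`) and
  `USTPeano.lemma46diam_of_lemma46hull` (hull form ⇒ printed form, same `δ`): the printed form
  sits between the two forms of `LSW2004USTUniformContinuity.lean`;
* consequences: `USTPeano.prop45_of_lemma46diam_of_drivingProcess_tendsto` (**Prop. 4.5 from
  Lemma 4.6 as printed and Thm. 4.4 as used on p. 981**),
  `USTPeano.hasSLETrace_eight_of_lemma46diam_of_drivingProcess_tendsto` and
  `USTPeano.hasSLETrace_eight_of_lemma46diam_of_thm44` (**[LSW04] Thm. 4.7 from Lemma 4.6 and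
  Thm. 4.4, both as printed**; the printed wording of Thm. 4.7 is the same proposition as
  `hasSLETrace_eight`, `LawlerSchrammWerner2004_thm47_iff_hasSLETrace_eight`, `SLETraceEight.lean`).

Rendering of the printed lemma in `h46` (as in `LSW2004USTUniformContinuity.lean` for everything
but `Y`): "`t₂ ≤ τ`" as "`|γ̂(s)| < ε⁻¹` for all `s ≤ t₂`", "`sup{…} ≥ ε`" through the sub-event
"some admissible pair `t₁ ≤ t₂` has `|γ̂(t₁) - γ̂(t₂)| ≥ ε`", "for all `R ≥ R₀`" as "`R > R₀`";
each renders a sub-event / weaker conclusion, so `h46` follows from Lemma 4.6 as printed.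

## References

* [LSW04] Lemma 2.1, Thm. 4.4 (p. 976), Prop. 4.5 (p. 977), Lemma 4.6 (p. 978) and the proof of
  Prop. 4.5 (end of §4.3), Thm. 4.7 (p. 981) [LawlerSchrammWerner2004].
* G. F. Lawler, *Conformally Invariant Processes in the Plane* (2005), Lemma 4.13, Rem. 4.9, §6.2
  [Lawler2005].
-/

noncomputable section

open Set Filter MeasureTheory Metric Complex
open _root_.Topology
open UpperHalfPlane (upperHalfPlaneSet)
open scoped NNReal ENNReal

namespace Literature.Probability.RandomPlanarGeometry

/-! ### Deterministic part: `Y(t₁, t₂)` and Lemma 2.1 for the shifted chain -/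

namespace Loewner

variable {W : ℝ≥0 → ℝ} {γ : ℝ≥0 → ℂ}

/-- **"Lemma 2.1 applied to the path `t ↦ g_{t₁} ∘ γ̂(t + t₁) - W(t₁)`"** ([LSW04] proof of
Prop. 4.5): for a chain generated by a simple curve, if `|W(s + r) - W(s)| ≤ S` for `r ≤ u` then
every point `g_s(γ̂(s + r))`, `0 < r ≤ u`, and the tip value `W(s)` (`r = 0`) of the increment
curve is within `S + 4√u` of `W(s)` — the point lies in the hull at time `u` of the shifted chain
(`incrCurve_mem_hull`), which is in that disc by [LSW04] Lemma 2.1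
(`hull_subset_closedBall_driving`, Lawler's Lemma 4.13). [cite: LawlerSchrammWerner2004, Lemma 2.1] -/
theorem norm_incrCurve_sub_driving_le (hγ : IsGeneratedByCurve W γ) (hs : IsSimpleTrace γ)
    (hW : Continuous W) (s : ℝ≥0) {u : ℝ≥0} {S : ℝ}
    (hS : ∀ r : ℝ≥0, r ≤ u → |W (s + r) - W s| ≤ S) {r : ℝ≥0} (hr : r ≤ u) :
    ‖incrCurve W γ s r - W s‖ ≤ S + 4 * Real.sqrt u := by
  have hS0 : 0 ≤ S := by simpa using hS 0 zero_le
  rcases eq_or_lt_of_le (show (0 : ℝ≥0) ≤ r from zero_le) with h0 | h0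
  · subst h0
    simp only [incrCurve_zero, sub_self, norm_zero]
    positivity
  · have hmem : incrCurve W γ s r ∈ hull (fun r' ↦ W (s + r')) u :=
      hull_mono _ hr (incrCurve_mem_hull hγ hs hW s h0)
    have h := hull_subset_closedBall_driving (continuous_shift W hW s) (u := u) (S := S)
      (fun r' hr' ↦ by simpa using hS r' hr') hmem
    simpa [mem_closedBall, dist_eq_norm] using h

/-- **The bound on LSW's `Y(t₁, t₂) = diam(g_{t₁} ∘ γ̂[t₁, t₂])`** ([LSW04] proof of Prop. 4.5:
"Lemma 2.1 applied to the path `t ↦ g_{t₁} ∘ γ̂(t + t₁) - W(t₁)` now implies …"): for a chain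
generated by a simple curve, with `s = t₁`, `u = t₂ - t₁`,
`Y(t₁, t₂) ≤ 2 (S + 4√(t₂ - t₁))` whenever `|W - W(t₁)| ≤ S` on `[t₁, t₂]`.
[cite: LawlerSchrammWerner2004, Lemma 2.1] -/
theorem ediam_image_incrCurve_le (hγ : IsGeneratedByCurve W γ) (hs : IsSimpleTrace γ)
    (hW : Continuous W) (s : ℝ≥0) {u : ℝ≥0} {S : ℝ}
    (hS : ∀ r : ℝ≥0, r ≤ u → |W (s + r) - W s| ≤ S) :
    Metric.ediam (incrCurve W γ s '' Icc 0 u) ≤ ENNReal.ofReal (2 * (S + 4 * Real.sqrt u)) := by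
  refine Metric.ediam_le fun p hp q hq ↦ ?_
  obtain ⟨r, hr, rfl⟩ := hp
  obtain ⟨r', hr', rfl⟩ := hq
  rw [edist_dist]
  apply ENNReal.ofReal_le_ofReal
  calc dist (incrCurve W γ s r) (incrCurve W γ s r')
      ≤ dist (incrCurve W γ s r) (W s) + dist ((W s : ℝ) : ℂ) (incrCurve W γ s r') :=
        dist_triangle _ _ _
    _ = ‖incrCurve W γ s r - W s‖ + ‖incrCurve W γ s r' - W s‖ := by
        rw [dist_eq_norm, dist_comm, dist_eq_norm]
    _ ≤ (S + 4 * Real.sqrt u) + (S + 4 * Real.sqrt u) :=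
        add_le_add (norm_incrCurve_sub_driving_le hγ hs hW s hS hr.2)
          (norm_incrCurve_sub_driving_le hγ hs hW s hS hr'.2)
    _ = 2 * (S + 4 * Real.sqrt u) := by ring

/-- **`Y(t₁, t₂) ≤ δ` controls the shifted hull**: for a chain generated by a simple curve, the
hull at time `u` of the chain driven by `W(s + ·)` is `g_s(γ̂(s, s + u])` (hull cocycle,
`hull_shift_eq_image_incrCurve`, Lawler's Rem. 4.9), a subset of `g_s ∘ γ̂[s, s + u] ∋ W(s)`; so if
the latter has diameter `≤ δ` the hull lies in the closed `δ`-disc about `W(s)`.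
[cite: LawlerSchrammWerner2004, Lemma 4.6] -/
theorem hull_shift_subset_closedBall_of_ediam_le (hγ : IsGeneratedByCurve W γ) (hs : IsSimpleTrace γ)
    (hW : Continuous W) (s u : ℝ≥0) {δ : ℝ} (hδ : 0 ≤ δ)
    (hY : Metric.ediam (incrCurve W γ s '' Icc 0 u) ≤ ENNReal.ofReal δ) :
    hull (fun r ↦ W (s + r)) u ⊆ closedBall ((W s : ℝ) : ℂ) δ := by
  intro w hw
  rw [hull_shift_eq_image_incrCurve hγ hs hW s u] at hw
  obtain ⟨r, hr, rfl⟩ := hw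
  rw [mem_closedBall, ← incrCurve_zero W γ s]
  have hr' : r ∈ Icc 0 u := ⟨hr.1.le, hr.2⟩
  have h0 : (0 : ℝ≥0) ∈ Icc 0 u := ⟨le_rfl, zero_le⟩
  have h := Metric.edist_le_ediam_of_mem (mem_image_of_mem (incrCurve W γ s) hr')
    (mem_image_of_mem (incrCurve W γ s) h0)
  rw [edist_dist] at h
  exact (ENNReal.ofReal_le_ofReal_iff hδ).1 (h.trans hY)

end Loewner

/-! ### The capacity image of a Peano path is a simple curve in `ℍ` -/

open scoped PathBorel

namespace USTPeano

/-- A time change `θ : [0, T) → [0, ∞)`, continuous with `θ(0) = 0` and `θ → ∞` at `T⁻`, attains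
every positive value inside `(0, T)` (intermediate value theorem). [folklore] -/
theorem exists_timeChange_eq {θ : ℝ → ℝ≥0} {T : ℝ} (hT : 0 < T) (hθc : ContinuousOn θ (Ico 0 T))
    (hθ0 : θ 0 = 0) (hθtop : Tendsto θ (𝓝[<] T) atTop) {r : ℝ≥0} (hr : 0 < r) :
    ∃ s ∈ Ioo 0 T, θ s = r := by
  have hev : ∀ᶠ s in 𝓝[<] T, r < θ s ∧ s ∈ Ioo 0 T :=
    (hθtop.eventually (eventually_gt_atTop r)).and (Ioo_mem_nhdsLT hT)
  obtain ⟨s₂, hrs₂, hs₂⟩ := hev.exists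
  have hcont : ContinuousOn θ (Icc 0 s₂) := hθc.mono (Icc_subset_Ico_right hs₂.2)
  have hmem : r ∈ Icc (θ 0) (θ s₂) := ⟨by rw [hθ0]; exact zero_le, hrs₂.le⟩
  obtain ⟨s, hs, hsr⟩ := intermediate_value_Icc hs₂.1.le hcont hmem
  have hs0 : s ≠ 0 := by
    rintro rfl
    rw [hθ0] at hsr
    exact hr.ne' hsr.symm
  exact ⟨s, ⟨lt_of_le_of_ne hs.1 (Ne.symm hs0), hs.2.trans_lt hs₂.2⟩, hsr⟩

variable {Δ : Domain} {φ : ConformalEquiv upperHalfPlaneSet Δ.carrier} {γ : PeanoPath Δ}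
  {γhat : C(ℝ≥0, ℂ)} {W : C(ℝ≥0, ℝ)}

/-- **The capacity image lies in `ℍ` for positive times**: `γ̂(r) = φ_R(γ(s))` for an interior time
`s` of the Peano path, and the open Peano path runs inside `D` (`PeanoPath.curve_mem_carrier`,
[LSW04] §4.1–4.2: `φ : D → ℍ` is applied to `γ`). [cite: LawlerSchrammWerner2004, Thm. 4.4] -/
theorem IsCapacityImage.im_pos (h : IsCapacityImage Δ φ γ γhat W) {r : ℝ≥0} (hr : 0 < r) :
    0 < (γhat r).im := by
  obtain ⟨θ, hθc, -, hθ0, hθtop, hθγ⟩ := h.exists_timeChange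
  have hT : (0 : ℝ) < γ.tlen := by exact_mod_cast γ.tlen_pos
  obtain ⟨s, hs, hsr⟩ := exists_timeChange_eq hT hθc hθ0 hθtop hr
  rw [← hsr, hθγ s hs]
  exact φ.symm_mapsTo (γ.curve_mem_carrier hs)

/-- **The capacity image is a simple curve**: `γ̂` is injective on `[0, ∞)` (the Peano path is a
simple polygon, `PeanoPath.injOn_curve`; `φ_R` is injective on `D`; and `γ̂(0) = 0 ∉ ℍ ∋ γ̂(r)`
for `r > 0`). [cite: LawlerSchrammWerner2004, Thm. 4.4] -/
theorem IsCapacityImage.injective (h : IsCapacityImage Δ φ γ γhat W) :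
    Function.Injective γhat := by
  obtain ⟨θ, hθc, -, hθ0, hθtop, hθγ⟩ := h.exists_timeChange
  have hT : (0 : ℝ) < γ.tlen := by exact_mod_cast γ.tlen_pos
  have hpos : ∀ r : ℝ≥0, 0 < r → ∃ s ∈ Ioo (0 : ℝ) γ.tlen, θ s = r := fun r hr ↦
    exists_timeChange_eq hT hθc hθ0 hθtop hr
  have him0 : ∀ r : ℝ≥0, 0 < r → γhat r ≠ 0 := fun r hr h0 ↦ by
    have := h.im_pos hr
    rw [h0, zero_im] at this
    exact lt_irrefl _ this
  intro r₁ r₂ heq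
  rcases eq_or_lt_of_le (show (0 : ℝ≥0) ≤ r₁ from zero_le) with h₁ | h₁ <;>
    rcases eq_or_lt_of_le (show (0 : ℝ≥0) ≤ r₂ from zero_le) with h₂ | h₂
  · rw [← h₁, ← h₂]
  · exfalso
    subst h₁
    rw [h.apply_zero] at heq
    exact him0 r₂ h₂ heq.symm
  · exfalso
    subst h₂
    rw [h.apply_zero] at heq
    exact him0 r₁ h₁ heq
  · obtain ⟨s₁, hs₁, hθ₁⟩ := hpos r₁ h₁
    obtain ⟨s₂, hs₂, hθ₂⟩ := hpos r₂ h₂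
    rw [← hθ₁, ← hθ₂, hθγ s₁ hs₁, hθγ s₂ hs₂] at heq
    have hc : γ.curve s₁ = γ.curve s₂ :=
      φ.symm.injOn (γ.curve_mem_carrier hs₁) (γ.curve_mem_carrier hs₂) heq
    have hs : s₁ = s₂ :=
      γ.injOn_curve ⟨hs₁.1.le, hs₁.2.le⟩ ⟨hs₂.1.le, hs₂.2.le⟩ hc
    rw [← hθ₁, ← hθ₂, hs]

/-- The capacity image is a **simple trace** in the sense of `Loewner.IsSimpleTrace` (injective, in
`ℍ` for positive times), so the increment-curve theory of `LoewnerSimpleIncrement.lean` applies to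
the chain it generates. [cite: LawlerSchrammWerner2004, Thm. 4.4] -/
theorem IsCapacityImage.isSimpleTrace (h : IsCapacityImage Δ φ γ γhat W) :
    Loewner.IsSimpleTrace γhat :=
  ⟨h.injective, fun _ ht ↦ h.im_pos ht⟩

/-- **The driving process starts at `0`**: `W(0) = γ̂(0) = φ_R(a^R) = 0`. [cite: LawlerSchrammWerner2004, Thm. 4.4] -/
theorem IsCapacityImage.driving_zero (h : IsCapacityImage Δ φ γ γhat W) : W 0 = 0 := by
  have h1 := h.isGeneratedByCurve.apply_zero
  rw [h.apply_zero] at h1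
  exact_mod_cast h1.symm

/-! ### The printed form of Lemma 4.6 versus the two forms used in the tree -/

/-- **Lemma 4.6 as printed implies its oscillation form** (the hypothesis `h46` of
`prop45_of_lemma46_of_drivingProcess_tendsto`), with `δ ↦ δ/10`: if `√(t₂ - t₁) ≤ δ/10` and
`|W(s) - W(t₁)| ≤ δ/10` on `[t₁, t₂]` then, `γ̂` being a simple curve
(`IsCapacityImage.isSimpleTrace`), `Y(t₁, t₂) ≤ 2 (δ/10 + 4 δ/10) = δ`
(`Loewner.ediam_image_incrCurve_le`, i.e. [LSW04] Lemma 2.1 for the shifted chain), so the event of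
the oscillation form at `δ/10` is contained in the printed event at `δ`. Here `h46` = **[LSW04]
Lemma 4.6** (p. 978, quoted in the module docstring) with
`Y(t₁, t₂) = diam(g_{t₁} ∘ γ̂[t₁, t₂]) = Metric.ediam (incrCurve W γ̂ t₁ '' [0, t₂ - t₁])`.
[cite: LawlerSchrammWerner2004, Lemma 4.6] -/
theorem lemma46osc_of_lemma46diam
    (h46 : ∀ (D : SmoothDomain) (ε : ℝ), 0 < ε →
      ∃ R₀ δ : ℝ, 0 < δ ∧ ∀ (R : ℝ) (Δ : Domain), R₀ < R → IsApproximation D R Δ →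
        ∀ (φ : ConformalEquiv upperHalfPlaneSet Δ.carrier), Δ.IsLSWMap φ →
          ∀ (Γ : PeanoPath Δ → C(ℝ≥0, ℂ)) (W : PeanoPath Δ → C(ℝ≥0, ℝ)),
            (∀ γ, IsCapacityImage Δ φ γ (Γ γ) (W γ)) →
              ustLaw Δ {γ | ∃ t₁ t₂ : ℝ≥0, t₁ ≤ t₂ ∧ (∀ s : ℝ≥0, s ≤ t₂ → ‖Γ γ s‖ < ε⁻¹) ∧
                Metric.ediam (Loewner.incrCurve (W γ) (Γ γ) t₁ '' Icc 0 (t₂ - t₁)) ≤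
                  ENNReal.ofReal δ ∧
                ε ≤ dist (Γ γ t₁) (Γ γ t₂)} < ENNReal.ofReal ε) :
    ∀ (D : SmoothDomain) (ε : ℝ), 0 < ε →
      ∃ R₀ δ : ℝ, 0 < δ ∧ ∀ (R : ℝ) (Δ : Domain), R₀ < R → IsApproximation D R Δ →
        ∀ (φ : ConformalEquiv upperHalfPlaneSet Δ.carrier), Δ.IsLSWMap φ →
          ∀ (Γ : PeanoPath Δ → C(ℝ≥0, ℂ)) (W : PeanoPath Δ → C(ℝ≥0, ℝ)),
            (∀ γ, IsCapacityImage Δ φ γ (Γ γ) (W γ)) →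
              ustLaw Δ {γ | ∃ t₁ t₂ : ℝ≥0, t₁ ≤ t₂ ∧ (∀ s : ℝ≥0, s ≤ t₂ → ‖Γ γ s‖ < ε⁻¹) ∧
                Real.sqrt ((t₂ : ℝ) - t₁) ≤ δ ∧
                (∀ s : ℝ≥0, t₁ ≤ s → s ≤ t₂ → |W γ s - W γ t₁| ≤ δ) ∧
                ε ≤ dist (Γ γ t₁) (Γ γ t₂)} < ENNReal.ofReal ε := by
  intro D ε hε
  obtain ⟨R₀, δ, hδ, H⟩ := h46 D ε hε
  refine ⟨R₀, δ / 10, by positivity, fun R Δ hR hΔ φ hφ Γ W hΓW ↦ ?_⟩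
  refine lt_of_le_of_lt (measure_mono ?_) (H R Δ hR hΔ φ hφ Γ W hΓW)
  intro γ hγ
  obtain ⟨t₁, t₂, h12, hτ, hsqrt, hosc, hε'⟩ := hγ
  refine ⟨t₁, t₂, h12, hτ, ?_, hε'⟩
  have hcap := hΓW γ
  have key := Loewner.ediam_image_incrCurve_le hcap.isGeneratedByCurve hcap.isSimpleTrace
    (W γ).continuous t₁ (u := t₂ - t₁) (S := δ / 10) (fun r hr ↦ hosc (t₁ + r) le_self_add <| by
      calc t₁ + r ≤ t₁ + (t₂ - t₁) := by gcongr
        _ = t₂ := add_tsub_cancel_of_le h12)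
  refine key.trans (ENNReal.ofReal_le_ofReal ?_)
  have hsq : Real.sqrt ((t₂ - t₁ : ℝ≥0) : ℝ) ≤ δ / 10 := by rwa [NNReal.coe_sub h12]
  linarith

/-- **The hull form of Lemma 4.6 implies the printed form** (same `δ`): if
`Y(t₁, t₂) = diam(g_{t₁} ∘ γ̂[t₁, t₂]) ≤ δ` then the hull at time `t₂ - t₁` of the chain driven by
`W(t₁ + ·)`, which is `g_{t₁}(γ̂(t₁, t₂])` for the simple curve `γ̂`
(`Loewner.hull_shift_eq_image_incrCurve`), lies in the closed `δ`-disc about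
`W(t₁) = g_{t₁}(γ̂(t₁))` (`Loewner.hull_shift_subset_closedBall_of_ediam_le`); so the printed event
at `δ` is contained in the hull-form event at `δ` (hypothesis of
`prop45_of_lemma46hull_of_drivingProcess_tendsto`). [cite: LawlerSchrammWerner2004, Lemma 4.6] -/
theorem lemma46diam_of_lemma46hull
    (h46 : ∀ (D : SmoothDomain) (ε : ℝ), 0 < ε →
      ∃ R₀ δ : ℝ, 0 < δ ∧ ∀ (R : ℝ) (Δ : Domain), R₀ < R → IsApproximation D R Δ →
        ∀ (φ : ConformalEquiv upperHalfPlaneSet Δ.carrier), Δ.IsLSWMap φ →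
          ∀ (Γ : PeanoPath Δ → C(ℝ≥0, ℂ)) (W : PeanoPath Δ → C(ℝ≥0, ℝ)),
            (∀ γ, IsCapacityImage Δ φ γ (Γ γ) (W γ)) →
              ustLaw Δ {γ | ∃ t₁ t₂ : ℝ≥0, t₁ ≤ t₂ ∧ (∀ s : ℝ≥0, s ≤ t₂ → ‖Γ γ s‖ < ε⁻¹) ∧
                Loewner.hull (fun s ↦ W γ (t₁ + s)) (t₂ - t₁) ⊆
                  closedBall ((W γ t₁ : ℝ) : ℂ) δ ∧
                ε ≤ dist (Γ γ t₁) (Γ γ t₂)} < ENNReal.ofReal ε) :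
    ∀ (D : SmoothDomain) (ε : ℝ), 0 < ε →
      ∃ R₀ δ : ℝ, 0 < δ ∧ ∀ (R : ℝ) (Δ : Domain), R₀ < R → IsApproximation D R Δ →
        ∀ (φ : ConformalEquiv upperHalfPlaneSet Δ.carrier), Δ.IsLSWMap φ →
          ∀ (Γ : PeanoPath Δ → C(ℝ≥0, ℂ)) (W : PeanoPath Δ → C(ℝ≥0, ℝ)),
            (∀ γ, IsCapacityImage Δ φ γ (Γ γ) (W γ)) →
              ustLaw Δ {γ | ∃ t₁ t₂ : ℝ≥0, t₁ ≤ t₂ ∧ (∀ s : ℝ≥0, s ≤ t₂ → ‖Γ γ s‖ < ε⁻¹) ∧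
                Metric.ediam (Loewner.incrCurve (W γ) (Γ γ) t₁ '' Icc 0 (t₂ - t₁)) ≤
                  ENNReal.ofReal δ ∧
                ε ≤ dist (Γ γ t₁) (Γ γ t₂)} < ENNReal.ofReal ε := by
  intro D ε hε
  obtain ⟨R₀, δ, hδ, H⟩ := h46 D ε hε
  refine ⟨R₀, δ, hδ, fun R Δ hR hΔ φ hφ Γ W hΓW ↦ ?_⟩
  refine lt_of_le_of_lt (measure_mono ?_) (H R Δ hR hΔ φ hφ Γ W hΓW)
  intro γ hγ
  obtain ⟨t₁, t₂, h12, hτ, hY, hε'⟩ := hγ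
  have hcap := hΓW γ
  exact ⟨t₁, t₂, h12, hτ, Loewner.hull_shift_subset_closedBall_of_ediam_le hcap.isGeneratedByCurve
    hcap.isSimpleTrace (W γ).continuous t₁ (t₂ - t₁) hδ.le hY, hε'⟩

/-! ### Prop. 4.5 and Thm. 4.7 from Lemma 4.6 as printed -/

/-- **[LSW04] Prop. 4.5 (uniform continuity estimate, p. 977) from Lemma 4.6 as printed and
Thm. 4.4 as used on p. 981** (`drivingProcess_tendsto`): `lemma46osc_of_lemma46diam` composed with
`prop45_of_lemma46_of_drivingProcess_tendsto` (the printed proof, pp. 978–981). The conclusion is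
the hypothesis `h45` of `hasSLETrace_eight_of_prop45_of_drivingProcess_tendsto`, verbatim.
[cite: LawlerSchrammWerner2004, Prop. 4.5] -/
theorem prop45_of_lemma46diam_of_drivingProcess_tendsto
    (h46 : ∀ (D : SmoothDomain) (ε : ℝ), 0 < ε →
      ∃ R₀ δ : ℝ, 0 < δ ∧ ∀ (R : ℝ) (Δ : Domain), R₀ < R → IsApproximation D R Δ →
        ∀ (φ : ConformalEquiv upperHalfPlaneSet Δ.carrier), Δ.IsLSWMap φ →
          ∀ (Γ : PeanoPath Δ → C(ℝ≥0, ℂ)) (W : PeanoPath Δ → C(ℝ≥0, ℝ)),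
            (∀ γ, IsCapacityImage Δ φ γ (Γ γ) (W γ)) →
              ustLaw Δ {γ | ∃ t₁ t₂ : ℝ≥0, t₁ ≤ t₂ ∧ (∀ s : ℝ≥0, s ≤ t₂ → ‖Γ γ s‖ < ε⁻¹) ∧
                Metric.ediam (Loewner.incrCurve (W γ) (Γ γ) t₁ '' Icc 0 (t₂ - t₁)) ≤
                  ENNReal.ofReal δ ∧
                ε ≤ dist (Γ γ t₁) (Γ γ t₂)} < ENNReal.ofReal ε)
    (h44 : drivingProcess_tendsto) :
    ∀ (D : SmoothDomain) (ε t : ℝ), 0 < ε → 0 < t →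
      ∃ R₀ δ : ℝ, 0 < δ ∧ ∀ (R : ℝ) (Δ : Domain), R₀ < R → IsApproximation D R Δ →
        ∀ (φ : ConformalEquiv upperHalfPlaneSet Δ.carrier), Δ.IsLSWMap φ →
          ∀ (Γ : PeanoPath Δ → C(ℝ≥0, ℂ)) (W : PeanoPath Δ → C(ℝ≥0, ℝ)),
            (∀ γ, IsCapacityImage Δ φ γ (Γ γ) (W γ)) →
              ustLaw Δ {γ | ∃ t₁ t₂ : ℝ≥0, (t₁ : ℝ) ≤ t ∧ (t₂ : ℝ) ≤ t ∧
                dist t₁ t₂ ≤ δ ∧ ε < dist (Γ γ t₁) (Γ γ t₂)} < ENNReal.ofReal ε :=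
  prop45_of_lemma46_of_drivingProcess_tendsto (lemma46osc_of_lemma46diam h46) h44

/-- **`hasSLETrace_eight` (SLE₈ is generated by a continuous curve, [LSW04] Thm. 4.7) from
Lemma 4.6 as printed and Thm. 4.4 as used on p. 981** (`drivingProcess_tendsto`).
[cite: LawlerSchrammWerner2004, Thm. 4.7] -/
theorem hasSLETrace_eight_of_lemma46diam_of_drivingProcess_tendsto
    (h46 : ∀ (D : SmoothDomain) (ε : ℝ), 0 < ε →
      ∃ R₀ δ : ℝ, 0 < δ ∧ ∀ (R : ℝ) (Δ : Domain), R₀ < R → IsApproximation D R Δ →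
        ∀ (φ : ConformalEquiv upperHalfPlaneSet Δ.carrier), Δ.IsLSWMap φ →
          ∀ (Γ : PeanoPath Δ → C(ℝ≥0, ℂ)) (W : PeanoPath Δ → C(ℝ≥0, ℝ)),
            (∀ γ, IsCapacityImage Δ φ γ (Γ γ) (W γ)) →
              ustLaw Δ {γ | ∃ t₁ t₂ : ℝ≥0, t₁ ≤ t₂ ∧ (∀ s : ℝ≥0, s ≤ t₂ → ‖Γ γ s‖ < ε⁻¹) ∧
                Metric.ediam (Loewner.incrCurve (W γ) (Γ γ) t₁ '' Icc 0 (t₂ - t₁)) ≤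
                  ENNReal.ofReal δ ∧
                ε ≤ dist (Γ γ t₁) (Γ γ t₂)} < ENNReal.ofReal ε)
    (h44 : drivingProcess_tendsto) : hasSLETrace_eight :=
  hasSLETrace_eight_of_lemma46_of_drivingProcess_tendsto (lemma46osc_of_lemma46diam h46) h44

/-- **`hasSLETrace_eight` from [LSW04] Lemma 4.6 and Thm. 4.4, BOTH AS PRINTED** (`h44` =
Thm. 4.4, p. 976, in the coupling shape of `drivingProcess_tendsto_of_thm44'`).
[cite: LawlerSchrammWerner2004, Thm. 4.7] -/
theorem hasSLETrace_eight_of_lemma46diam_of_thm44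
    (h46 : ∀ (D : SmoothDomain) (ε : ℝ), 0 < ε →
      ∃ R₀ δ : ℝ, 0 < δ ∧ ∀ (R : ℝ) (Δ : Domain), R₀ < R → IsApproximation D R Δ →
        ∀ (φ : ConformalEquiv upperHalfPlaneSet Δ.carrier), Δ.IsLSWMap φ →
          ∀ (Γ : PeanoPath Δ → C(ℝ≥0, ℂ)) (W : PeanoPath Δ → C(ℝ≥0, ℝ)),
            (∀ γ, IsCapacityImage Δ φ γ (Γ γ) (W γ)) →
              ustLaw Δ {γ | ∃ t₁ t₂ : ℝ≥0, t₁ ≤ t₂ ∧ (∀ s : ℝ≥0, s ≤ t₂ → ‖Γ γ s‖ < ε⁻¹) ∧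
                Metric.ediam (Loewner.incrCurve (W γ) (Γ γ) t₁ '' Icc 0 (t₂ - t₁)) ≤
                  ENNReal.ofReal δ ∧
                ε ≤ dist (Γ γ t₁) (Γ γ t₂)} < ENNReal.ofReal ε)
    (h44 : ∀ (ε₁ ε₂ ε₃ T : ℝ), 0 < ε₁ → 0 < ε₂ → 0 < ε₃ → 0 < T → ∃ r₁ : ℝ, ∀ (Δ : Domain),
      (0 : ℂ) ∈ Δ.carrier → ball (0 : ℂ) r₁ ⊆ Δ.carrier →
      ∀ (φ : ConformalEquiv upperHalfPlaneSet Δ.carrier), Δ.IsLSWMap φ →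
        ε₁ * Real.pi ≤ arg (φ.symm 0) → arg (φ.symm 0) ≤ (1 - ε₁) * Real.pi →
        ∀ (Γ : PeanoPath Δ → C(ℝ≥0, ℂ)) (W : PeanoPath Δ → C(ℝ≥0, ℝ)),
          (∀ γ, IsCapacityImage Δ φ γ (Γ γ) (W γ)) →
          ∃ ρ : Measure (C(ℝ≥0, ℝ) × C(ℝ≥0, ℝ)), ρ.fst = (ustLaw Δ).map W ∧
            ρ.snd = Process.preWienerMeasure.map brownianTimeEight ∧
            ρ {p | ∃ t : ℝ≥0, (t : ℝ) ≤ T ∧ ε₂ < dist (p.1 t) (p.2 t)} < ENNReal.ofReal ε₃) :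
    hasSLETrace_eight :=
  hasSLETrace_eight_of_lemma46diam_of_drivingProcess_tendsto h46 (drivingProcess_tendsto_of_thm44' h44)

end USTPeano

end Literature.Probability.RandomPlanarGeometry
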